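import Mathlib.FieldTheory.IntermediateField.Basic
import Mathlib.FieldTheory.Galois.Basic
import Mathlib.NumberTheory.NumberField.Units.Basic
import Mathlib.Analysis.SpecialFunctions.Log.Basic
import Literature.AlgebraicGeometry.Frobenioids.ArithmeticDivisorsUnits
import Literature.AlgebraicGeometry.Frobenioids.LogPrimesTranscendence
import Literature.AlgebraicGeometry.Frobenioids.FinSubextCat
import Literature.AlgebraicGeometry.Frobenioids.DivisorMonoidCategoryTheoreticity
import HarnessLib

/-!
# Frobenioids I, §6 "Some motivating examples": Example 6.3 (the Frobenioid side), Theorem 6.4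
# (Arithmetic Frobenioids), Lemma 6.5

Mochizuki, *The geometry of Frobenioids I: the general theory*, Kyushu J. Math. **62** (2008)
293–400, kurims text pp. 112–117 [cite: MochizukiFrdI2008, §6 pp.112-117]. Thm. 6.4 (15 citations) and
Ex. 6.3 (12) are the most cited items of [FrdI] in IUT I–IV.

The base category `D = B(G)⁰` of Ex. 6.3 (`FinSubextCat F K`, finite subextensions with
`Hom(Spec L, Spec M) = Hom_F(M, L)`) and the subgroup `Z ⊆ G` of elements commuting with an open subgroup
are DEFINED in `FinSubextCat.lean` (split out; proofs of Frobenius-slimness / the slimness criterion by seat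
abc-iut-L6-t10 in `FinSubextCatSlim.lean`).

What enters as INTERFACE/parameters, with locators: the divisor monoid `Φ : L ↦ Φ(L)` of effective
arithmetic divisors (values DEFINED in `ArithmeticDivisors.lean`; its pull-back maps along `M → L`
multiply finite coordinates by ramification indices — recorded as the data `ArithDivisorMonoidOn`,
`TODO(construct): via Mathlib ramification indices`); the model Frobenioid `C_{F̃/F}` of Thm. 5.2 (ii),
its perfection/realification/unit-trivialisation `C^pf`, `C^rlf`, `C^un-tr` and `Pic_Φ` (Thm. 5.1, Prop.
5.3, Cor. 5.4: seat abc-iut-L1-t2) — through `PreFrobenioidData` and the structure `ArithRealification`.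

Typed: Ex. 6.3's claim "`Prime(Φ(L)) ≃ V(L)`" ("`O^×(A) = O^▷(A) = μ(L)`" is PROVED in
`ArithmeticDivisorsUnits.lean` as: the kernel of `div : L^× → Φ(L)^gp` is the roots of unity); Thm. 6.4 (i) (two decls + the `δ` field of `ArithRealification`), (ii), (iii), (iv);
Lem. 6.5 (i) is PROVED in `LogPrimesLinearIndependent.lean`; Lem. 6.5 (ii) is typed in `LogPrimesTranscendence.lean` (discharged by seat abc-iut-L6-t10 via the tree's six exponentials theorem).
Deliberately NOT here: Ex. 6.1 / Thm. 6.2 (geometric Frobenioids: proper normal varieties and Cartier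
divisors are absent from Mathlib — separate interface file), Rem. 6.2.1, 6.3.1 (prose).
No statement of the paper is strengthened; nothing asserts anything about abc.
-/

noncomputable section

namespace Literature.AlgebraicGeometry.Frobenioids

open CategoryTheory NumberField

universe u v w

/-! ### Example 6.3: the arithmetic divisor monoid on `D` and the claims about it -/

section Ex63

variable (F : Type) [Field F] [NumberField F] (K : Type) [Field K] [Algebra F K] [IsGalois F K]

/-- INTERFACE (`TODO(construct)`, via Mathlib ramification indices): the divisor monoid of Ex. 6.3 as a
monoid ON `D` — values `Φ(L)` = effective arithmetic divisors of `L` (DEFINED, `EffArithDivisor`), and the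
pull-back maps `Φ(M) → Φ(L)` along `Spec L → Spec M` ("`Φ`, `B`, as well as `B → Φ^gp` are functorial in
the number field `F`", FrdI p. 113), compatible with `div : L^× → Φ(L)^gp`.
[cite: MochizukiFrdI2008, Ex. 6.3 p.113] -/
structure ArithDivisorMonoidOn where
  /-- pull-back of effective arithmetic divisors along `σ : M → L` -/
  pull : ∀ {X Y : FinSubextCat F K}, (Y ⟶ X) →
    (Multiplicative (EffArithDivisor X.L) →* Multiplicative (EffArithDivisor Y.L))
  /-- functoriality: identity -/
  pull_id : ∀ (X : FinSubextCat F K) (x), pull (𝟙 X) x = x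
  /-- functoriality: composition -/
  pull_comp : ∀ {X Y Z : FinSubextCat F K} (β : Z ⟶ Y) (α : Y ⟶ X) (x), pull (β ≫ α) x = pull β (pull α x)
  /-- compatibility with principal divisors: `div(σ f) = σ^* div(f)` in `Φ^gp` -/
  pull_div : ∀ {X Y : FinSubextCat F K} (σ : Y ⟶ X) (f : (X.L)ˣ) (D E : EffArithDivisor X.L),
    EffArithDivisor.toArithDivisor X.L D - EffArithDivisor.toArithDivisor X.L E = principalArithDivisor X.L f →
      EffArithDivisor.toArithDivisor Y.L (Multiplicative.toAdd (pull σ (Multiplicative.ofAdd D))) -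
          EffArithDivisor.toArithDivisor Y.L (Multiplicative.toAdd (pull σ (Multiplicative.ofAdd E))) =
        principalArithDivisor Y.L (Units.map (σ.toAlgHom : X.L →* Y.L) f)

/-- The effective arithmetic divisor "supported at `v`" with coefficient `1` (finite `v`: `ord_v = 1`;
archimedean `v`: the coordinate `1 ∈ ℝ_{≥0}` at `v`). [cite: MochizukiFrdI2008, Ex. 6.3 p.113] -/
def EffArithDivisor.single (L : Type) [Field L] [NumberField L] : Places L → EffArithDivisor L
  | Sum.inl w => (0, fun w' => by classical exact if w' = w then 1 else 0)
  | Sum.inr v => (Finsupp.single v 1, 0)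

/-- **Example 6.3**, claim "there is a natural bijection `Prime(Φ(L)) ≃ V(L)`" (FrdI p. 113), typed as the
EXPLICIT map: the divisor supported at `v` is a primary element of the monoid `Φ(L)` of effective arithmetic
divisors (`Monoids.lean`) and `v ↦` its `≼`-class is a bijection `V(L) → Prime(Φ(L))` (audit F5: not a bare
cardinality statement; "`Φ(L)` perf-factorial", "supports = finite subsets of `V(L)`" are §2 vocabulary,
seat abc-iut-L1-t2). [cite: MochizukiFrdI2008, Ex. 6.3 p.113] -/
def Ex63_primes (L : Type) [Field L] [NumberField L] : Prop :=
  ∃ h : ∀ v : Places L, IsPrimary (Multiplicative.ofAdd (EffArithDivisor.single L v)),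
    Function.Bijective fun v : Places L =>
      (Quotient.mk (primarySetoid _) ⟨_, h v⟩ : Primes (Multiplicative (EffArithDivisor L)))

-- Example 6.3's claim "`O^×(A) = O^▷(A) = μ(L)`" (p. 113) is PROVED in `ArithmeticDivisorsUnits.lean`
-- (`principalArithDivisor_eq_zero_iff`: `div(x) = 0 ↔ x` is a root of unity).

end Ex63

/-! ### Theorem 6.4 (Arithmetic Frobenioids) -/

section Thm64

variable (F : Type) [Field F] [NumberField F] (K : Type) [Field K] [Algebra F K] [IsGalois F K]

/-- The data "`C` = the model Frobenioid of Thm. 5.2 (ii) associated to `(Φ, B, B → Φ^gp)` of Ex. 6.3 over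
`D = B(Gal(K/F))⁰`" (FrdI Thm. 6.4 p. 114), as operations over `FinSubextCat F K` whose divisor monoids are
the effective arithmetic divisors: INTERFACE for seat abc-iut-L1-t2's Thm. 5.2 (`TODO-merge`).
[cite: MochizukiFrdI2008, Thm. 6.4 p.114] -/
structure ArithModelFrobenioid (C : Type u) [Category.{v} C] where
  /-- the operations `(Base, Div, deg_Fr)` of `C → F_Φ` -/
  ops : PreFrobenioidData.{0} C (FinSubextCat F K)
  /-- `Φ(Spec L)` is the monoid of effective arithmetic divisors on `L` -/
  monEquiv : ∀ X : FinSubextCat F K, ops.Mon X ≃* Multiplicative (EffArithDivisor X.L)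

variable {F K}
variable {C : Type u} [Category.{v} C] (M : ArithModelFrobenioid F K C)

/-- **Theorem 6.4 (i)**, Frobenioid part (typed over the interfaces): `C`, `C^pf`, `C^rlf`, `C^un-tr`,
`(C^pf)^un-tr` are of isotropic and rationally standard type but not of group-like type — recorded for `C`
and its unit-trivialisation (the others over their data, seat abc-iut-L1-t2), with "rationally standard"
as the structured hypothesis `IsOfRationallyStandardType R` over explicit parameters `R : RSParams` (FrdI p. 114).
SCHEMA (W2-8 (5)) over the data-only `M`, `R` — THE instance is abc-iut-L6-t10's `arithModelFrobenioid F K`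
(`ArithmeticFrobenioidsProofs.lean`, over the CONSTRUCTED `arithFrobenioid F K := ModelFrobenioid …`), for which
the isotropic conjunct is abc-iut-L1-t2's `ModelFrobenioid.ofModel_isOfIsotropicType`.
[cite: MochizukiFrdI2008, Thm. 6.4 (i) p.114] -/
def Thm64i_frobenioid (R : M.ops.RSParams) : Prop :=
  M.ops.IsOfIsotropicType ∧ M.ops.IsOfRationallyStandardType R ∧ ¬ M.ops.IsOfGroupLikeType

/-- **Theorem 6.4 (i)**, base part: `D` is Frobenius-slim and Div-slim (w.r.t. `Φ`), and `D` is slim iff the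
subgroup of elements of `G` commuting with some open subgroup is trivial (FrdI p. 114). Over the data-only
`M`; CLOSED for THE instance: abc-iut-L6-t10's `Thm64i_base_arith : Thm64i_base (arithModelFrobenioid F K)`
(PROVED, `ArithmeticFrobenioidsProofs.lean` / `ArithmeticFrobenioidDivSlim.lean`).
[cite: MochizukiFrdI2008, Thm. 6.4 (i) p.114] -/
def Thm64i_base : Prop :=
  IsFrobeniusSlim (FinSubextCat F K) ∧ M.ops.IsDivSlim ∧
    (IsSlim (FinSubextCat F K) ↔ commOpenSubgroup F K = {1})

/-- INTERFACE for the realification `C^rlf` (Prop. 5.3) of the arithmetic Frobenioid together with `Pic_Φ`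
(Thm. 5.1) on its Frobenius-trivial objects and the isomorphisms `δ_A : Pic_Φ(A) ≃ ℝ` determined by
`deg^arith_L` — the last assertion of Thm. 6.4 (i) (FrdI pp. 114–115: surjective formally, injective by "the
well-known Dirichlet unit theorem") is the existence of this field `δ`; seat abc-iut-L1-t2 (`TODO-merge`)
owns `C^rlf`/`Pic_Φ`. [cite: MochizukiFrdI2008, Thm. 6.4 (i) p.114] -/
structure ArithRealification (Rlf : Type u) [Category.{v} Rlf] where
  /-- its operations over `D` (divisor monoid `Φ^rlf`) -/
  ops : PreFrobenioidData.{0} Rlf (FinSubextCat F K)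
  /-- `Pic_Φ(A)` for `A ∈ Ob(C^rlf)` (Thm. 5.1 (i)) -/
  Pic : Rlf → Type
  [instPic : ∀ A, AddCommGroup (Pic A)]
  /-- `δ_A : Pic_Φ(A) ≃ ℝ` for Frobenius-trivial `A`, induced by `deg^arith_L` -/
  δ : ∀ A : Rlf, ops.IsFrobeniusTrivial A → (Pic A ≃+ ℝ)

/-- `Pic_Φ(A)` is an abelian group (structure-carried instance, exposed). [cite: MochizukiFrdI2008, Thm. 5.1 p.96] -/
instance ArithRealification.instAddCommGroupPic {Rlf : Type u} [Category.{v} Rlf]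
    (R : ArithRealification (F := F) (K := K) Rlf) (A : Rlf) : AddCommGroup (R.Pic A) := R.instPic A

variable {F₁ : Type} [Field F₁] [NumberField F₁] {K₁ : Type} [Field K₁] [Algebra F₁ K₁] [IsGalois F₁ K₁]
variable {F₂ : Type} [Field F₂] [NumberField F₂] {K₂ : Type} [Field K₂] [Algebra F₂ K₂] [IsGalois F₂ K₂]
variable {Rlf₁ : Type u} [Category.{v} Rlf₁] {Rlf₂ : Type u} [Category.{v} Rlf₂]
variable (R₁ : ArithRealification (F := F₁) (K := K₁) Rlf₁) (R₂ : ArithRealification (F := F₂) (K := K₂) Rlf₂)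

/-- **Theorem 6.4 (ii)**, the degree relation (v3): `deg` "is" the degree of `Ψ^rlf : C₁^rlf ⥲ C₂^rlf` — for
Frobenius-trivial `A₁ ↦ A₂ = Ψ^rlf(A₁)`, the composite of `δ_{A₂}` with the isomorphism `Pic_Φ(A₁) ≃ Pic_Φ(A₂)`
determined by `Ψ^rlf` (Cor. 4.10, 4.11 (iii); the parameter `picMap`) equals `deg · δ_{A₁}`, and `deg > 0`
(FrdI p. 114). Factored out of `Thm64ii` so that (iii)/(iv) speak about THE degree (reader note T64-N1,
abc-iut-L1-t10). SCHEMA (W2-8 (5)) over the data-only `R₁`, `R₂` and the parameters `Ψ`, `picMap` — faithful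
only for THE realifications (Prop. 5.3 / Thm. 5.1, seat abc-iut-L1-t2) and THE induced `picMap`.
[cite: MochizukiFrdI2008, Thm. 6.4 (ii) p.114] -/
def Thm64iiDeg (Ψ : Rlf₁ ≌ Rlf₂) (picMap : ∀ A : Rlf₁, R₁.Pic A ≃+ R₂.Pic (Ψ.functor.obj A)) (deg : ℝ) : Prop :=
  0 < deg ∧ ∀ (A : Rlf₁) (hA : R₁.ops.IsFrobeniusTrivial A)
    (hA' : R₂.ops.IsFrobeniusTrivial (Ψ.functor.obj A)) (x : R₁.Pic A),
      R₂.δ _ hA' (picMap A x) = deg * R₁.δ A hA x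

/-- **Theorem 6.4 (ii)**: an equivalence `Ψ^rlf : C₁^rlf ⥲ C₂^rlf` has a *degree* `deg(Ψ^rlf) ∈ ℝ_{>0}`
(FrdI p. 114): `∃ deg, Thm64iiDeg … deg`. SCHEMA (W2-8 (5); L1-lead ruling 2026-08-25T21:13:25Z (C)) over
`R₁`, `R₂`, `Ψ`, `picMap`: as a closed statement over a free `picMap` it is false (replace `picMap` by
`-picMap`); faithful only when `C_i^rlf`, `Pic_Φ`, `δ_A` are THE constructions and `picMap` is THE map induced
by `Ψ`; not a closed citable fact and not a discharge row until then. [cite: MochizukiFrdI2008, Thm. 6.4 (ii) p.114] -/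
def Thm64ii (Ψ : Rlf₁ ≌ Rlf₂)
    (picMap : ∀ A : Rlf₁, R₁.Pic A ≃+ R₂.Pic (Ψ.functor.obj A)) : Prop :=
  ∃ deg : ℝ, Thm64iiDeg R₁ R₂ Ψ picMap deg

/-- **Theorem 6.4 (iii)** (v3): if `Ψ^rlf` (of degree `deg`, `Thm64iiDeg`) arises — `1`-commutes through the
comparison functors `u_i : (C_i^pf)^un-tr ⥤ C_i^rlf` (Prop. 5.5 / Cor. 5.4, parameters) — from an equivalence
`Ψ' : (C₁^pf)^un-tr ⥲ (C₂^pf)^un-tr`, then `deg ∈ ℚ_{>0}`; and for `A₁ ∈ Ob((C₁^pf)^un-tr)` over `Spec L₁`,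
`A₂ = Ψ'(A₁)` over `Spec L₂` (the projections read through `u_i` and `Base`), the bijection
`V(L₁) ≃ Prime(Φ₁(L₁)) ≃ Prime(Φ₂(L₂)) ≃ V(L₂)` induced by `Ψ'` (Cor. 4.11 (iii); the parameter `placeMap`)
maps a valuation over `v₀ ∈ V(ℚ)` to one over the same `v₀` — same residue characteristic at finite places,
archimedean ↔ archimedean (FrdI pp. 114–115). SCHEMA (W2-8 (5); reader note T64-N1) over `R₁`, `R₂`, `Ψ`,
`picMap`, `u_i`, `Ψ'`, `placeMap` — faithful only for THE realifications, comparison functors and induced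
bijection of places; not a closed citable fact. [cite: MochizukiFrdI2008, Thm. 6.4 (iii) p.114] -/
def Thm64iii (Ψ : Rlf₁ ≌ Rlf₂) (picMap : ∀ A : Rlf₁, R₁.Pic A ≃+ R₂.Pic (Ψ.functor.obj A)) (deg : ℝ)
    {U₁ : Type u} [Category.{v} U₁] {U₂ : Type u} [Category.{v} U₂] (u₁ : U₁ ⥤ Rlf₁) (u₂ : U₂ ⥤ Rlf₂)
    (Ψ' : U₁ ≌ U₂) (A₁ : U₁)
    (placeMap : Places (R₁.ops.base.obj (u₁.obj A₁)).L ≃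
      Places (R₂.ops.base.obj (u₂.obj (Ψ'.functor.obj A₁))).L) : Prop :=
  Thm64iiDeg R₁ R₂ Ψ picMap deg → OneCommutes Ψ'.functor u₂ u₁ Ψ.functor →
    (∃ q : ℚ, 0 < q ∧ deg = q) ∧
      (∀ w : InfinitePlace (R₁.ops.base.obj (u₁.obj A₁)).L,
          ∃ w' : InfinitePlace (R₂.ops.base.obj (u₂.obj (Ψ'.functor.obj A₁))).L,
            placeMap (Sum.inl w) = Sum.inl w') ∧
      ∀ w : FinitePlace (R₁.ops.base.obj (u₁.obj A₁)).L,
        ∃ w' : FinitePlace (R₂.ops.base.obj (u₂.obj (Ψ'.functor.obj A₁))).L,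
          placeMap (Sum.inr w) = Sum.inr w' ∧
            (Ideal.absNorm w.maximalIdeal.asIdeal).minFac = (Ideal.absNorm w'.maximalIdeal.asIdeal).minFac

/-- **Theorem 6.4 (iv)** (v3): if `Ψ^rlf` (of degree `deg`, `Thm64iiDeg`) arises — `1`-commutes through the
realification functors `r_i : C_i ⥤ C_i^rlf` (Prop. 5.3, parameters) — from an equivalence `Ψ : C₁ ⥲ C₂`,
then `deg = 1`; and if some finite `L₁ ⊆ F̃₁` over `F₁` is Galois over `ℚ`, the corresponding — via THE
`Ψ^Base : D₁ ⥲ D₂` of Cor. 4.11 (ii) (`PreFrobenioidData.OneUniqueSquare` over the operations `M_i` of the `C_i`) — `L₂ ⊆ F̃₂` is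
isomorphic to `L₁` compatibly with an isomorphism `F₁ ≅ F₂` (FrdI p. 115). SCHEMA (W2-8 (5); T64-N1) over
`R₁`, `R₂`, `Ψrlf`, `picMap`, `M_i`, `r_i` — faithful only for THE realifications and realification functors;
not a closed citable fact. [cite: MochizukiFrdI2008, Thm. 6.4 (iv) p.115] -/
def Thm64iv (Ψrlf : Rlf₁ ≌ Rlf₂) (picMap : ∀ A : Rlf₁, R₁.Pic A ≃+ R₂.Pic (Ψrlf.functor.obj A)) (deg : ℝ)
    {C₁ : Type u} [Category.{v} C₁] {C₂ : Type u} [Category.{v} C₂]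
    (M₁ : ArithModelFrobenioid F₁ K₁ C₁) (M₂ : ArithModelFrobenioid F₂ K₂ C₂)
    (r₁ : C₁ ⥤ Rlf₁) (r₂ : C₂ ⥤ Rlf₂) (Ψ : C₁ ≌ C₂) (ΨBase : FinSubextCat F₁ K₁ ⥤ FinSubextCat F₂ K₂) : Prop :=
  Thm64iiDeg R₁ R₂ Ψrlf picMap deg → OneCommutes Ψ.functor r₂ r₁ Ψrlf.functor →
    PreFrobenioidData.OneUniqueSquare Ψ.functor M₁.ops.base M₂.ops.base ΨBase →
      deg = 1 ∧
        ∀ X : FinSubextCat F₁ K₁, IsGalois ℚ X.L →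
          ∃ (e : X.L ≃+* (ΨBase.obj X).L) (e₀ : F₁ ≃+* F₂),
            ∀ a : F₁, e (algebraMap F₁ X.L a) = algebraMap F₂ (ΨBase.obj X).L (e₀ a)

end Thm64

end Literature.AlgebraicGeometry.Frobenioids

end
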